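import Mathlib
import Literature.Computability.Complexity.PoweringConstruction
import HarnessLib

/-!
# DissociatedFixedKUniformC

Topic `Literature/Uncategorized`. Named literature fact(s) relocated by the gate from `Summits/ValiantsHypothesis/ValiantsHypothesis/Theorems/DissociatedFixedK/Negative/UniformCFalse.lean`
(accept-time relocation of `[cite]`d propositions written inline in a Summits proposal; human ruling 2026-08-15).

* `Literature.Uncategorized.DissociatedFixedKUniformC` — **a FALSE statement, kept only as the named target of its
  refutation** `Summit.ValiantsHypothesis.ValiantsHypothesis.Theorems.DissociatedFixedK.Negative.not_dissociatedFixedKUniformC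
  : ¬ DissociatedFixedKUniformC` (in the Summits file above, accepted and sorry-free, axioms `propext`,
  `Classical.choice`, `Quot.sound`).  It is NOT a literature fact: no source asserts it, there is and can be no
  `DissociatedFixedKUniformC_holds`, and no result may take `(h : DissociatedFixedKUniformC)` as a hypothesis
  (anything follows from it).  The refuting witness is Koiran–Portier–Tavenas–Thomassé, *A τ-conjecture for Newton
  polygons* (arXiv:1308.2286, bib `KoiranPortierTavenasThomasse2015`), Example 3 + Lemma 2 + Prop. 1 made explicit:
  base-`b` digit grids `P_j = {(b^{2j} i, b^j i') : i < b², i' < b}` (dissociated, `#P_j ≤ b³ = t`), `m = 3C+3` factors,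
  `b = (3C+5)^C + 1`, and `k = b^m` products of monomials realise the `b^m` chain points `(y(y-1)/2, y)`, all of them
  vertices, and `b^m = t^{C+1} > (m t + 2)^C`.  The TRUE statement with the quantifiers in the other order
  (`∀ k, ∃ C`) is the summit-side route item `DissociatedFixedK` (stmt-ValiantsHypothesis-5907) and is deliberately
  not restated here.
* Verdict clean-up 2026-08-16 (librarian): the declaration is now `@[deprecated]` (name and body byte-identical), like the
  other refuted route-stub weakenings parked in this directory; it stays in this module because its refutation, an
  append-only `Summits/…/Theorems` file, imports `Literature.Uncategorized.DissociatedFixedKUniformC` and names it.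
-/

namespace Literature.Uncategorized

open Finset
open Literature.Computability.Complexity.Expander.RotGraph (digit digit_lt)

/-- **FALSE as stated (refuted in the tree) — a named statement, not a fact; never a hypothesis.**
`DissociatedFixedK` with the quantifiers `∀ k, ∃ C` swapped to `∃ C, ∀ k`: ONE exponent `C` such that for every
number `k` of products, every number `m` of factors, every `t`, every family of supports `A j` (`j < m`) of size
`≤ t` that is dissociated (the sum map `Π_j A j → ℕ²` is injective) and every `f i j` supported in `A j`, the Newton
polygon of `∑_{i<k} ∏_{j<m} f i j` has at most `(m t + 2)^C` vertices.  Its negation is the accepted theorem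
`Summit.ValiantsHypothesis.ValiantsHypothesis.Theorems.DissociatedFixedK.Negative.not_dissociatedFixedKUniformC`
(witness: Koiran–Portier–Tavenas–Thomassé arXiv:1308.2286, Example 3 + Lemma 2 + Prop. 1, see the module
docstring), so `DissociatedFixedKUniformC_holds` does not exist and cannot; this `def` was relocated here by the
gate from that Summits file and is kept unchanged only because the refutation refers to it by name.  The
provenance tag below records where the (false) quantifier-swapped formulation comes from, not an endorsement.
Deprecated 2026-08-16 (librarian verdict clean-up: refuted, not a literature fact — the attribute takes it out of the
named-fact debt census; the two Summits-side users, the refutation and the crux work file, keep compiling with a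
deprecation warning). [folklore] -/
@[deprecated "REFUTED as stated (quantifier swap ∃ C ∀ k of the route item DissociatedFixedK): see theorem \
    Summit.ValiantsHypothesis.ValiantsHypothesis.Theorems.DissociatedFixedK.Negative.not_dissociatedFixedKUniformC \
    (module Summits.ValiantsHypothesis.ValiantsHypothesis.Theorems.DissociatedFixedK.Negative.UniformCFalse); \
    the true statement with ∀ k ∃ C is the route item DissociatedFixedK (stmt-ValiantsHypothesis-5907)"
  (since := "2026-08-16")]
def DissociatedFixedKUniformC : Prop :=
  ∃ C : ℕ, ∀ (k m t : ℕ) (A : Fin m → Finset (Fin 2 →₀ ℕ))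
    (f : Fin k → Fin m → MvPolynomial (Fin 2) ℂ),
    (∀ j, (A j).card ≤ t) → (∀ i j, (f i j).support ⊆ A j) →
    (∀ a b : Fin m → (Fin 2 →₀ ℕ), (∀ j, a j ∈ A j) → (∀ j, b j ∈ A j) → ∑ j, a j = ∑ j, b j → a = b) →
    (Set.extremePoints ℝ (convexHull ℝ ((fun e : Fin 2 →₀ ℕ => fun i : Fin 2 => ((e i : ℕ) : ℝ)) ''
      ((∑ i, ∏ j, f i j).support : Set (Fin 2 →₀ ℕ))))).ncard ≤ (m * t + 2) ^ C

end Literature.Uncategorized
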